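import Summits.QuantumFields.BalabanUV.Beta.GAN24.CouplingLetterStencil

/-!
# `BalabanUV.Beta.GAN24.CouplingLetterWordInputs` — binder row G-an2-4 ∕ (CONV-C), route R7 «TWO CURRENCIES», PART 237: EVERY WORD IN COUPLING LETTERS
# `X_{w,k} = L^{dk}Q_k(𝒢A_{i₁}𝒢A_{i₂}⋯𝒢A_{i_n}𝒢)Q_kᴴ`, `A_i = P(V₁ᵢ) + P(V₂ᵢ)ᴴ + diag Wᵢ` (first order + ADJOINT placement + ZEROTH order — the class of the exact abelian covariant
# Laplacian `Δ^U − Δ^1`, NE2's `covPert_eq`), HAS (UD)+(SR) VOLUME-FREE AND EL₂ MODULO ONLY THE BACKGROUNDS' POINTWISE LIMITS; HENCE `c_k⁻¹X_{w,k}c_k⁻¹` HAS THE β-CELL's WHOLE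
# `LimitRate` END ON `ℤ^d`.  PART 159 VERBATIM with the three letter facts of PART 236 (`norm_couplingLetter_mul_apply_le`, `tendsto_couplingLetter_mul_pair`,
# `perturbationLaws_couplingLetter`, `hPc_couplingLetter`) in place of PART 151's ∕ NE2's first-order ones; PART 159 §1 (tail words) and §3 (`opNorm_conjMat_word_le`) are GENERIC and
# imported BY NAME (unit b2b-balaban-gan24-p3, gen 65; v1; generator `HOME/b2b-balaban-gan24-p3/gen65/records/gen/gen237.py` over the tree text of PART 159)

NOT IN PRINT; OUR PROOF ([folklore] bookkeeping BY NAME over PART 159 (`tendsto_mul_tailWord_pair`, `opNorm_conjMat_word_le`), PART 236, PART 122 (`towerLimitRate_word`, `chain_eq_mul_tailProd`),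
PART 126 (`hdecB_of_conjBound`), PART 124 (`exists_admissible_rate`, `conjDefect_calDalev_rho`, `max_JA_lt_gamD`), PART 143 (`conv_insertion_invCov_of_kernel`), PART 145 ∕ 146 ∕ 151
(`exists_fineWindowDecay_calGlev`, `tendsto_calGlev_pair`, `tendsto_avgTow_pair_of_fine`), NE2's `freeTowerLaws_balaban`, `C2adj_nonneg`; [Balaban1987RG1] (1.21)–(1.22) p. 264 LOCATE the
shapes; nothing printed is a hypothesis).
HONEST FRAMING (cell contract, verbatim): «discharging `BetaPertH` makes Bałaban's UV stability UNCONDITIONAL — a real constructive-QFT result; it is NOT the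
continuum limit and NOT the Clay problem.»  HONEST DEPENDENCY (verbatim): «continuum YM on T⁴ ⇐ BetaPertH ∧ nine spine estimates (0/9 proved); BetaPertH ⇐
(D1) ∧ (D4) ∧ CAP+tail; G-an2-4 gates asym, D1 and NE2/3/4.»

WHAT THIS FILE PROVES (0 sorry, 0 `def`; `𝒢 = calGlev = Δ_a⁻¹`, `A_i = Pmodel V₁ᵢ + (Pmodel V₂ᵢ)ᴴ + diag Wᵢ`, `T_{w,k} = foldr (fun i N ↦ 𝒢_kA_{i,k}N) 𝒢_k w`, `X_{w,k} = L^{dk}Q_kT_{w,k}Q_kᴴ`;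
`V₁ᵢ, V₂ᵢ` `LipschitzBackground (α, β)`, `Wᵢ` `BoundedBackground (α′, β′)`, common constants over the family):
* §1 **`tendsto_couplingWord_fine_pair`**, **`tendsto_couplingWord_pair`** (EL₂ of `T_w` ∕ `X_w` for EVERY word, modulo EL₁ of `V₁, V₂, W`).
* §2 **`couplingWord_decay_inputs`** ((UD)+(SR) volume-free: `∃ κ > 0, B, B′ ≥ 0` from `(d, L, a, α, β, α′, β′, |w|)` for EVERY torus and EVERY such family).
* §3 **`couplingWord_inputs`** (the INPUT triple along the even cubic volumes), **`conv_couplingWord_of_tendsto_background`** (the END of `c_k⁻¹X_{w,k}c_k⁻¹` on `ℤ^d`).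
WHAT IT DOES NOT DO: the diagrams ∕ Taylor coefficients (PART 238); `d ≤ 2` ∕ odd volumes.  SUPPLIER work; NEVER «G-an2-4 closed»; NOT (CONV-C), NOT D1, NOT `BetaPertH`, NOT continuum,
NOT Clay.  Records: `HOME/b2b-balaban-gan24-p3/gen65/README.md`.
-/

noncomputable section

open scoped BigOperators ComplexConjugate Matrix Matrix.Norms.L2Operator
open Filter Topology

namespace Summit.QuantumFields.BalabanUV.Beta.GAN24.CouplingLetterWordInputs

open Literature.MathematicalPhysics.QuantumFieldTheory.Balaban1983to89
open Literature.MathematicalPhysics.QuantumFieldTheory.Balaban1983to89.B5Prop11Plancherel (Tor fine Cst Cst_nonneg)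
open Literature.MathematicalPhysics.QuantumFieldTheory.Balaban1983to89.B5G183RateUnitTower (lev)
open Literature.MathematicalPhysics.QuantumFieldTheory.Balaban1983to89.B12Sec2to5 (l1 betaPrime510)
open Literature.MathematicalPhysics.QuantumFieldTheory.Balaban1983to89.Beta (Site windowMap IsInfiniteVolumeLimit)
open Literature.MathematicalPhysics.QuantumFieldTheory.Balaban1983to89.Beta.FreeLegDictionary (cubic)
open Literature.MathematicalPhysics.QuantumFieldTheory.Balaban1983to89.Beta.BlockKernelVolumeSockets (evenPeriod tendsto_evenPeriod)
open Literature.MathematicalPhysics.QuantumFieldTheory.Balaban1983to89.Beta.VectorTails (castT)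
open Literature.MathematicalPhysics.QuantumFieldTheory.Balaban1983to89.Beta.LimitRate (StepRate limKernelOf KernelInputs)
open Summit.QuantumFields.BalabanUV.T4Continuum
open Summit.QuantumFields.BalabanUV.T4Continuum.BackgroundResolventLaw (l2_opNorm_one_le)
open Summit.QuantumFields.BalabanUV.T4Continuum.CovariantAveragingTower (avgTow)
open Summit.QuantumFields.BalabanUV.T4Continuum.BalabanAveragedTowerUnit (idx QBlev calGlev unitCovB one_le_lev')
open Summit.QuantumFields.BalabanUV.T4Continuum.BalabanAveragedCoerciveTower (unitIdx)
open Summit.QuantumFields.BalabanUV.T4Continuum.BalabanAveragingPairing (freeTowerLaws_balaban)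
open Summit.QuantumFields.BalabanUV.T4Continuum.KingPairingPlantedLaw (calDalev calDalev_inv CJ CJ_nonneg)
open Summit.QuantumFields.BalabanUV.T4Continuum.FirstOrderBackgroundModel (LipschitzBackground Pmodel C2model)
open Summit.QuantumFields.BalabanUV.T4Continuum.FirstOrderAdjointModel (C2adj C2adj_nonneg)
open Summit.QuantumFields.BalabanUV.T4Continuum.PerturbationAlgebra (BoundedBackground)
open Summit.QuantumFields.BalabanUV.T4Continuum.CTWeightedCoercivity (conjMat conjMat_one WCoercive)
open Summit.QuantumFields.BalabanUV.T4Continuum.CTAveragedTowerDecay (opNorm_conjMat_inv_le_of_wCoercive conjMat_mul_same)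
open Summit.QuantumFields.BalabanUV.T4Continuum.CTKingTowerWeights (rho distK)
open Summit.QuantumFields.BalabanUV.T4Continuum.CTConjugatedHbd (G2 G2_nonneg wCoercive_calDa_of_conjDefect)
open Summit.QuantumFields.BalabanUV.T4Continuum.CTConjDefectDischarge (conjDefect_calDalev_rho max_JA_lt_gamD)
open Summit.QuantumFields.BalabanUV.T4Continuum.DirichletRegionTower (gamD)
open Summit.QuantumFields.BalabanUV.T4Continuum.CTVectorPropagator (JA)
open Summit.QuantumFields.BalabanUV.T4Continuum.DecayRateInterpolation (EntryDecay DecayRate TwoLevelDecayRate decayRate_of_towerLimitRate)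
open Summit.QuantumFields.BalabanUV.Beta.GAN24.DiagramDecayAlgebra (entryDecay_add)
open Summit.QuantumFields.BalabanUV.Beta.GAN24.UnitLatticeDecayAlgebra (distK_nonneg)
open Summit.QuantumFields.BalabanUV.Beta.GAN24.EffectiveFormDecay (entryDecay_of_le_rate)
open Summit.QuantumFields.BalabanUV.Beta.GAN24.InsertionChainDecay (exists_admissible_rate)
open Summit.QuantumFields.BalabanUV.Beta.GAN24.InsertionChainDecayBalaban (hdecB_of_conjBound)
open Summit.QuantumFields.BalabanUV.Beta.GAN24.InsertionChainLawWords (chain_eq_mul_tailProd towerLimitRate_word)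
open Summit.QuantumFields.BalabanUV.Beta.GAN24.DiagramVolumeLimitPairs (l1_windowMap_neg)
open Summit.QuantumFields.BalabanUV.Beta.GAN24.DiagramVolumeLimitSandwich (conv_insertion_invCov_of_kernel)
open Summit.QuantumFields.BalabanUV.Beta.GAN24.FinePropagatorDecay (exists_fineWindowDecay_calGlev)
open Summit.QuantumFields.BalabanUV.Beta.GAN24.FineInsertionVolumeLimit (tendsto_calGlev_pair)
open Summit.QuantumFields.BalabanUV.Beta.GAN24.PerturbedPropagatorVolumeLimit (tendsto_avgTow_pair_of_fine)
open Summit.QuantumFields.BalabanUV.Beta.GAN24.InsertionWordVolumeLimit (tendsto_mul_tailWord_pair opNorm_conjMat_word_le)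
open Summit.QuantumFields.BalabanUV.Beta.GAN24.CouplingLetterStencil (norm_couplingLetter_mul_apply_le tendsto_couplingLetter_mul_pair perturbationLaws_couplingLetter hPc_couplingLetter)

variable {d : ℕ} (L : ℕ) [NeZero L] (a : ℝ) (ha : 0 < a)


/-! ## §1 EL₂ of every word in coupling letters, modulo the backgrounds' pointwise limits -/

section WordLimits

/-- **`tendsto_couplingWord_fine_pair` — EL₂ OF THE FINE KERNEL `T_{w,k} = 𝒢A_{i₁}𝒢⋯A_{i_n}𝒢` AT FINE INTEGER PAIRS, EVERY WORD, MODULO EL₁ OF THE BACKGROUNDS** [our proof] (`d ≥ 3`,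
`a > 0`, level `k`, even cubic volumes; a family of Lipschitz backgrounds `V_{i,t}` with common `(α, β)`): `T_w = 𝒢·R_w`, `R_w = foldr (P(V_i)𝒢·—) 1 w` (PART 122's right shift);
each letter `A_i𝒢` is left-window-decaying volume-free (PART 236 on PART 145) with EL₂ (PART 236 on PART 146), so PART 159 §1 applies. [cite: Balaban1987RG1, p.264 (after (1.21): the
`T ↗ ℤ^d` limit)] -/
theorem tendsto_couplingWord_fine_pair (hd : 3 ≤ d) (k : ℕ) {σ : Type*} {α β α' β' : ℝ}
    {V₁ V₂ : σ → (t : ℕ) → (k : ℕ) → Fin d → (idx L (cubic d (evenPeriod t)) k → ℂ)} {W : σ → (t : ℕ) → (k : ℕ) → (idx L (cubic d (evenPeriod t)) k → ℂ)}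
    (hV₁ : ∀ i t, LipschitzBackground L (cubic d (evenPeriod t)) (V₁ i t) α β) (hV₂ : ∀ i t, LipschitzBackground L (cubic d (evenPeriod t)) (V₂ i t) α β)
    (hW : ∀ i t, BoundedBackground L (cubic d (evenPeriod t)) (W i t) α' β')
    (hV₁1 : ∀ i (μ f : Fin d) (z : Fin d → ℤ), ∃ s : ℂ, Tendsto (fun t => V₁ i t k μ (castT (cubic d (lev L k * evenPeriod t)) z, f)) atTop (𝓝 s))
    (hV₂1 : ∀ i (μ f : Fin d) (z : Fin d → ℤ), ∃ s : ℂ, Tendsto (fun t => V₂ i t k μ (castT (cubic d (lev L k * evenPeriod t)) z, f)) atTop (𝓝 s))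
    (hW1 : ∀ i (f : Fin d) (z : Fin d → ℤ), ∃ s : ℂ, Tendsto (fun t => W i t k (castT (cubic d (lev L k * evenPeriod t)) z, f)) atTop (𝓝 s))
    (w : List σ) (f g : Fin d) (z z' : Fin d → ℤ) :
    ∃ s : ℂ, Tendsto (fun t => (List.foldr (fun i N => calGlev L (cubic d (evenPeriod t)) a ha k * (Pmodel L (cubic d (evenPeriod t)) (V₁ i t) k + (Pmodel L (cubic d (evenPeriod t)) (V₂ i t) k)ᴴ + Matrix.diagonal (W i t k)) * N)
        (calGlev L (cubic d (evenPeriod t)) a ha k) w)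
      (castT (cubic d (lev L k * evenPeriod t)) z, f) (castT (cubic d (lev L k * evenPeriod t)) z', g)) atTop (𝓝 s) := by
  rcases isEmpty_or_nonempty σ with hσ | ⟨⟨i₀⟩⟩
  · cases w with
    | nil => simp only [List.foldr_nil]; exact tendsto_calGlev_pair L a ha hd k f g z z'
    | cons i _ => exact (IsEmpty.false i).elim
  have hd1 : 1 ≤ d := le_trans (by norm_num) hd
  have hd0 : (0 : ℝ) < d := by exact_mod_cast lt_of_lt_of_le zero_lt_one hd1
  have hn : (0 : ℝ) < lev L k := by exact_mod_cast Nat.pos_of_ne_zero (NeZero.ne (lev L k))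
  have hside : Tendsto (fun t => lev L k * evenPeriod t) atTop atTop :=
    Filter.Tendsto.const_mul_atTop' (Nat.pos_of_ne_zero (NeZero.ne (lev L k))) tendsto_evenPeriod |>.congr fun t => by ring
  have hα : 0 ≤ α := (hV₁ i₀ 0).nonneg.1
  have hα' : 0 ≤ α' := (hW i₀ 0).nonneg.1
  obtain ⟨κ, C, hκ, hC, hdec⟩ := exists_fineWindowDecay_calGlev L a ha
  have hδ : 0 < κ / (d * lev L k) := div_pos hκ (mul_pos hd0 hn)
  have hGr : ∀ t (w : Site d (lev L k * evenPeriod t)) (g : Fin d) (y : Site d (lev L k * evenPeriod t)) (h : Fin d),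
      ‖calGlev L (cubic d (evenPeriod t)) a ha k (w, g) (y, h)‖ ≤ C * Real.exp (-(κ / (d * lev L k)) * l1 (windowMap d (lev L k * evenPeriod t) (w - y))) :=
    fun t w g y h => hdec (evenPeriod t) k w y g h
  have hGl : ∀ t (x : Site d (lev L k * evenPeriod t)) (f : Fin d) (w : Site d (lev L k * evenPeriod t)) (g : Fin d),
      ‖calGlev L (cubic d (evenPeriod t)) a ha k (x, f) (w, g)‖ ≤ C * Real.exp (-(κ / (d * lev L k)) * l1 (windowMap d (lev L k * evenPeriod t) (w - x))) := by
    intro t x f w g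
    have h := hdec (evenPeriod t) k x w f g
    rwa [show x - w = -(w - x) from (neg_sub w x).symm, l1_windowMap_neg] at h
  have hGel := fun f g w w' => tendsto_calGlev_pair L a ha hd k f g w w'
  set CX : ℝ := 2 * (d * (α * lev L k * ((Real.exp (3 * (κ / (d * lev L k))) + 1) * C))) + α' * C with hCX
  have hCX0 : 0 ≤ CX := by positivity
  -- the letters `A_i𝒢`: left-window decay and EL₂
  have hXdecl : ∀ i t (x : Site d (lev L k * evenPeriod t)) (f : Fin d) (w : Site d (lev L k * evenPeriod t)) (g : Fin d),
      ‖((Pmodel L (cubic d (evenPeriod t)) (V₁ i t) k + (Pmodel L (cubic d (evenPeriod t)) (V₂ i t) k)ᴴ + Matrix.diagonal (W i t k)) * calGlev L (cubic d (evenPeriod t)) a ha k) (x, f) (w, g)‖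
        ≤ CX * Real.exp (-(κ / (d * lev L k)) * l1 (windowMap d (lev L k * evenPeriod t) (w - x))) := by
    intro i t x f w g
    have h := norm_couplingLetter_mul_apply_le L (evenPeriod t) (hV₁ i t) (hV₂ i t) (hW i t) k hC hδ.le (hGr t) x f w g
    rwa [show x - w = -(w - x) from (neg_sub w x).symm, l1_windowMap_neg] at h
  have hXel : ∀ i (f g : Fin d) (z z' : Fin d → ℤ), ∃ s : ℂ, Tendsto (fun t => ((Pmodel L (cubic d (evenPeriod t)) (V₁ i t) k + (Pmodel L (cubic d (evenPeriod t)) (V₂ i t) k)ᴴ + Matrix.diagonal (W i t k)) * calGlev L (cubic d (evenPeriod t)) a ha k)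
      (castT (cubic d (lev L k * evenPeriod t)) z, f) (castT (cubic d (lev L k * evenPeriod t)) z', g)) atTop (𝓝 s) :=
    fun i => tendsto_couplingLetter_mul_pair L (side := evenPeriod) k (V₁ i) (V₂ i) (W i) (hV₁1 i) (hV₂1 i) (hW1 i) (G := fun t => calGlev L (cubic d (evenPeriod t)) a ha k) hGel
  -- the right shift `T_w = 𝒢·R_w`
  have e : ∀ t, List.foldr (fun i N => calGlev L (cubic d (evenPeriod t)) a ha k * (Pmodel L (cubic d (evenPeriod t)) (V₁ i t) k + (Pmodel L (cubic d (evenPeriod t)) (V₂ i t) k)ᴴ + Matrix.diagonal (W i t k)) * N) (calGlev L (cubic d (evenPeriod t)) a ha k) w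
      = calGlev L (cubic d (evenPeriod t)) a ha k
        * List.foldr (fun i N => (Pmodel L (cubic d (evenPeriod t)) (V₁ i t) k + (Pmodel L (cubic d (evenPeriod t)) (V₂ i t) k)ᴴ + Matrix.diagonal (W i t k)) * calGlev L (cubic d (evenPeriod t)) a ha k * N) 1 w :=
    fun t => chain_eq_mul_tailProd (calGlev L (cubic d (evenPeriod t)) a ha k) (fun i => (Pmodel L (cubic d (evenPeriod t)) (V₁ i t) k + (Pmodel L (cubic d (evenPeriod t)) (V₂ i t) k)ᴴ + Matrix.diagonal (W i t k))) w
  simp only [e]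
  exact tendsto_mul_tailWord_pair (d := d) (F := Fin d) (side := fun t => lev L k * evenPeriod t) hside
    (G := fun t => calGlev L (cubic d (evenPeriod t)) a ha k)
    (A := fun i t => (Pmodel L (cubic d (evenPeriod t)) (V₁ i t) k + (Pmodel L (cubic d (evenPeriod t)) (V₂ i t) k)ᴴ + Matrix.diagonal (W i t k)) * calGlev L (cubic d (evenPeriod t)) a ha k) hδ hCX0 hGl hXdecl hGel hXel w f g z z'

/-- **`tendsto_couplingWord_pair` — EL₂ OF THE AVERAGED WORD `X_{w,k} = L^{dk}Q_kT_{w,k}Q_kᴴ` ON THE UNIT LATTICE, EVERY WORD, MODULO EL₁ OF THE BACKGROUNDS** [our proof] (`d ≥ 3`, even cubic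
volumes): PART 151's middle-free stencil on `tendsto_couplingWord_fine_pair`. [cite: Balaban1987RG1, p.264 (after (1.21): the `T ↗ ℤ^d` limit)] -/
theorem tendsto_couplingWord_pair (hd : 3 ≤ d) (k : ℕ) {σ : Type*} {α β α' β' : ℝ}
    {V₁ V₂ : σ → (t : ℕ) → (k : ℕ) → Fin d → (idx L (cubic d (evenPeriod t)) k → ℂ)} {W : σ → (t : ℕ) → (k : ℕ) → (idx L (cubic d (evenPeriod t)) k → ℂ)}
    (hV₁ : ∀ i t, LipschitzBackground L (cubic d (evenPeriod t)) (V₁ i t) α β) (hV₂ : ∀ i t, LipschitzBackground L (cubic d (evenPeriod t)) (V₂ i t) α β)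
    (hW : ∀ i t, BoundedBackground L (cubic d (evenPeriod t)) (W i t) α' β')
    (hV₁1 : ∀ i (μ f : Fin d) (z : Fin d → ℤ), ∃ s : ℂ, Tendsto (fun t => V₁ i t k μ (castT (cubic d (lev L k * evenPeriod t)) z, f)) atTop (𝓝 s))
    (hV₂1 : ∀ i (μ f : Fin d) (z : Fin d → ℤ), ∃ s : ℂ, Tendsto (fun t => V₂ i t k μ (castT (cubic d (lev L k * evenPeriod t)) z, f)) atTop (𝓝 s))
    (hW1 : ∀ i (f : Fin d) (z : Fin d → ℤ), ∃ s : ℂ, Tendsto (fun t => W i t k (castT (cubic d (lev L k * evenPeriod t)) z, f)) atTop (𝓝 s))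
    (w : List σ) (μ ν : Fin d) (z z' : Fin d → ℤ) :
    ∃ s : ℂ, Tendsto (fun t => (avgTow (QBlev L (cubic d (evenPeriod t))) ((L : ℝ) ^ d)
        (fun k' => List.foldr (fun i N => calGlev L (cubic d (evenPeriod t)) a ha k' * (Pmodel L (cubic d (evenPeriod t)) (V₁ i t) k' + (Pmodel L (cubic d (evenPeriod t)) (V₂ i t) k')ᴴ + Matrix.diagonal (W i t k')) * N)
          (calGlev L (cubic d (evenPeriod t)) a ha k') w) k)
      ((unitIdx L (cubic d (evenPeriod t))).symm (castT (cubic d (evenPeriod t)) z, μ)) ((unitIdx L (cubic d (evenPeriod t))).symm (castT (cubic d (evenPeriod t)) z', ν))) atTop (𝓝 s) := by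
  obtain ⟨s, hs⟩ := tendsto_avgTow_pair_of_fine L k
    (X := fun t k' => List.foldr (fun i N => calGlev L (cubic d (evenPeriod t)) a ha k' * (Pmodel L (cubic d (evenPeriod t)) (V₁ i t) k' + (Pmodel L (cubic d (evenPeriod t)) (V₂ i t) k')ᴴ + Matrix.diagonal (W i t k')) * N)
      (calGlev L (cubic d (evenPeriod t)) a ha k') w)
    (fun f g u u' => tendsto_couplingWord_fine_pair L a ha hd k hV₁ hV₂ hW hV₁1 hV₂1 hW1 w f g u u') μ ν z z'
  refine ⟨s, hs.congr fun t => ?_⟩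
  simp only [Matrix.reindex_apply, Matrix.submatrix_apply]

end WordLimits

/-! ## §2 (UD)+(SR) of every word in coupling letters, volume-free -/



/-- **`couplingWord_decay_inputs` — (UD)+(SR) OF EVERY MIXED INSERTION WORD, VOLUME-FREE** (`L ≥ 2`, `d ≥ 1`, `σ` non-empty, `w` any word): `∃ κ > 0, B, B′ ≥ 0` from
`(d, L, a, α, β, α′, β′, |w|)` such that for EVERY torus `M` and EVERY family with `LipschitzBackground L M (V₁ i) α β`, `LipschitzBackground L M (V₂ i) α β`, `BoundedBackground L M (W i) α′ β′` (all `i`): (UD) `EntryDecay distK X_{w,k} B κ` ∀ `k` and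
(SR) `TwoLevelDecayRate distK X_w B′ κ (√(L⁻¹))` — PART 122's `towerLimitRate_word` on Bałaban's tower (NE2's `freeTowerLaws_balaban` ∕ `perturbationLaws_firstOrder`) + PART 126's
dictionary on §3's conjugated bound at PART 124's admissible rate, joined by `decayRate_of_towerLimitRate`; (UD) = limit decay + the `DecayRate` clause at half the rate (PART 158 is
`w = [i₁, i₂]`, PART 156 §2 the constant words). -/
theorem couplingWord_decay_inputs (hL : 2 ≤ L) (hd : 1 ≤ d) (α β α' β' : ℝ) {σ : Type*} [Nonempty σ] (w : List σ) :
    ∃ κ B B' : ℝ, 0 < κ ∧ 0 ≤ B ∧ 0 ≤ B' ∧ ∀ (M : Fin d → ℕ) [∀ μ, NeZero (M μ)] (V₁ V₂ : σ → (k : ℕ) → Fin d → (idx L M k → ℂ)) (W : σ → (k : ℕ) → (idx L M k → ℂ)),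
      (∀ i, LipschitzBackground L M (V₁ i) α β) → (∀ i, LipschitzBackground L M (V₂ i) α β) → (∀ i, BoundedBackground L M (W i) α' β') →
      (∀ k, EntryDecay (distK L M) (avgTow (QBlev L M) ((L : ℝ) ^ d)
        (fun k => List.foldr (fun i N => calGlev L M a ha k * (Pmodel L M (V₁ i) k + (Pmodel L M (V₂ i) k)ᴴ + Matrix.diagonal (W i k)) * N) (calGlev L M a ha k) w) k) B κ) ∧
      TwoLevelDecayRate (distK L M) (avgTow (QBlev L M) ((L : ℝ) ^ d)
        (fun k => List.foldr (fun i N => calGlev L M a ha k * (Pmodel L M (V₁ i) k + (Pmodel L M (V₂ i) k)ᴴ + Matrix.diagonal (W i k)) * N) (calGlev L M a ha k) w)) B' κ (Real.sqrt ((L : ℝ)⁻¹)) := by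
  obtain ⟨i₀⟩ := ‹Nonempty σ›
  obtain ⟨κ, hκ0, -, hγ', hδ', hJA⟩ := exists_admissible_rate d a
  have hJγ : max (JA d a 1 κ 1) 0 < gamD d a := max_JA_lt_gamD a hJA
  set J : ℝ := max (JA d a 1 κ 1) 0 with hJ
  set κc : ℝ := d * (α * G2 d a J (gamD d a - J) κ) + d * (Real.exp |κ| * (α * G2 d a J (gamD d a - J) κ + β * (gamD d a - J)⁻¹)) + α' * (gamD d a - J)⁻¹ with hκc
  set κ₀ : ℝ := 2 * (d * (α + β) * Cst d a) + α' * Cst d a with hκ₀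
  -- the decay constant and the rate constant of the word
  set Bl : ℝ := (gamD d a - J)⁻¹ * κc ^ w.length * Real.exp (κ * 4) with hBl
  set C : ℝ := ((w.length + 1) * κ₀ ^ w.length * CJ d a + w.length * κ₀ ^ (w.length - 1) * (C2model d L a α β + C2adj d L a α β + Cst d a * β' * Cst d a))
    + κ₀ ^ w.length * (2 * d * Cst d a + 2 * (d * L * Cst d a)) with hCdef
  set R : ℝ := Real.sqrt (2 * Bl * (C / (1 - (L : ℝ)⁻¹))) with hR
  set R' : ℝ := Real.sqrt (2 * Bl * (2 * C / (1 - (L : ℝ)⁻¹))) with hR'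
  have hL1 : (1 : ℝ) < L := by exact_mod_cast (lt_of_lt_of_le one_lt_two hL : 1 < L)
  have hρ0 : (0 : ℝ) ≤ (L : ℝ)⁻¹ := inv_nonneg.mpr (Nat.cast_nonneg _)
  have hρ1 : ((L : ℝ)⁻¹) < 1 := inv_lt_one_of_one_lt₀ hL1
  have hr : (0 : ℝ) < (L : ℝ) ^ d := pow_pos (lt_trans zero_lt_one hL1) d
  have hθ0 : 0 ≤ Real.sqrt ((L : ℝ)⁻¹) := Real.sqrt_nonneg _
  have hθ1 : Real.sqrt ((L : ℝ)⁻¹) ≤ 1 := by rw [Real.sqrt_le_one]; exact inv_le_one_of_one_le₀ hL1.le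
  refine ⟨κ / 2, max Bl 0 + R, R', half_pos hκ0, add_nonneg (le_max_right _ _) (Real.sqrt_nonneg _), Real.sqrt_nonneg _, fun M _ V₁ V₂ W hV₁ hV₂ hW => ?_⟩
  obtain ⟨hα, hβ⟩ := (hV₁ i₀).nonneg
  obtain ⟨hα', hβ'⟩ := (hW i₀).nonneg
  have hCst := Cst_nonneg d a
  have hCJ := CJ_nonneg d a
  have hκ₀0 : 0 ≤ κ₀ := by positivity
  have hC2 : 0 ≤ C2model d L a α β + C2adj d L a α β + Cst d a * β' * Cst d a := by
    have h1 : 0 ≤ C2model d L a α β := by unfold C2model; positivity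
    have h2 := C2adj_nonneg d L a hα hβ
    positivity
  have hC0 : 0 ≤ C := by positivity
  have hκc0 : 0 ≤ κc := by
    have := G2_nonneg (d := d) a J (sub_pos.mpr hJγ) κ
    have : 0 ≤ (gamD d a - J)⁻¹ := inv_nonneg.mpr (sub_pos.mpr hJγ).le
    positivity
  -- the rate half (PART 122 on Bałaban's tower)
  have hT := towerLimitRate_word hr (freeTowerLaws_balaban L M a ha) (fun i => perturbationLaws_couplingLetter L M a ha hd (hV₁ i) (hV₂ i) (hW i)) hκ₀0
    (fun k => mul_nonneg hC2 (pow_nonneg hρ0 k)) hρ1 (fun k => le_rfl) (fun k => le_rfl) (fun k => le_rfl) (fun k => le_rfl) w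
  -- the decay half (PART 126's dictionary on the conjugated bound)
  have hWc : ∀ (k : ℕ) (y : idx L M 0), WCoercive (calDalev L M a ha k) κ (rho L M k y) (gamD d a - J) :=
    fun k y => wCoercive_calDa_of_conjDefect (lev L k) (one_le_lev' L k) M a ha (conjDefect_calDalev_rho L M a ha one_pos hγ' hδ' k y)
  have hPc : ∀ i (k : ℕ) (y : idx L M 0),
      ‖conjMat κ (rho L M k y) (rho L M k y) ((Pmodel L M (V₁ i) k + (Pmodel L M (V₂ i) k)ᴴ + Matrix.diagonal (W i k))) * conjMat κ (rho L M k y) (rho L M k y) (calDalev L M a ha k)⁻¹‖ ≤ κc :=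
    fun i k y => hPc_couplingLetter L M a ha (hV₁ i) (hV₂ i) (hW i) (le_max_right _ _) hJγ k y (conjDefect_calDalev_rho L M a ha one_pos hγ' hδ' k y)
  have hdec : ∀ k, EntryDecay (distK L M) (avgTow (QBlev L M) ((L : ℝ) ^ d)
      (fun k => List.foldr (fun i N => (calDalev L M a ha k)⁻¹ * (Pmodel L M (V₁ i) k + (Pmodel L M (V₂ i) k)ᴴ + Matrix.diagonal (W i k)) * N) (calDalev L M a ha k)⁻¹ w) k) Bl κ := by
    intro k
    have h := hdecB_of_conjBound L M (X := fun k => List.foldr (fun i N => (calDalev L M a ha k)⁻¹ * (Pmodel L M (V₁ i) k + (Pmodel L M (V₂ i) k)ᴴ + Matrix.diagonal (W i k)) * N) (calDalev L M a ha k)⁻¹ w)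
      hκ0.le (fun k y => opNorm_conjMat_word_le L a ha M (hWc k y) (sub_pos.mpr hJγ) hκc0 (fun i => hPc i k y) w) k
    rw [hBl]
    exact h
  obtain ⟨clim, -, hlim, hrate, hstep⟩ := decayRate_of_towerLimitRate hρ0 hρ1 hC0 hT hdec
  -- rewrite the family to the `calGlev` form
  have e : (fun k => List.foldr (fun i N => (calDalev L M a ha k)⁻¹ * (Pmodel L M (V₁ i) k + (Pmodel L M (V₂ i) k)ᴴ + Matrix.diagonal (W i k)) * N) (calDalev L M a ha k)⁻¹ w)
      = fun k => List.foldr (fun i N => calGlev L M a ha k * (Pmodel L M (V₁ i) k + (Pmodel L M (V₂ i) k)ᴴ + Matrix.diagonal (W i k)) * N) (calGlev L M a ha k) w := by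
    funext k; rw [calDalev_inv]
  rw [e] at hrate hstep
  refine ⟨fun k => ?_, fun k x y => (hstep k x y).trans (le_of_eq (by rw [hR']))⟩
  have hlim' : EntryDecay (distK L M) clim (max Bl 0) κ := fun x y => (hlim x y).trans (mul_le_mul_of_nonneg_right (le_max_left _ _) (Real.exp_pos _).le)
  have h1 : EntryDecay (distK L M) clim (max Bl 0) (κ / 2) := entryDecay_of_le_rate (distK_nonneg L M) hlim' (le_max_right _ _) (half_le_self hκ0.le)
  have h2 : EntryDecay (distK L M) (avgTow (QBlev L M) ((L : ℝ) ^ d)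
      (fun k => List.foldr (fun i N => calGlev L M a ha k * (Pmodel L M (V₁ i) k + (Pmodel L M (V₂ i) k)ᴴ + Matrix.diagonal (W i k)) * N) (calGlev L M a ha k) w) k - clim) R (κ / 2) := by
    intro x y
    refine (hrate k x y).trans ?_
    rw [hR]
    exact mul_le_mul_of_nonneg_right (mul_le_of_le_one_right (Real.sqrt_nonneg _) (pow_le_one₀ hθ0 hθ1)) (Real.exp_pos _).le
  have e2 : avgTow (QBlev L M) ((L : ℝ) ^ d) (fun k => List.foldr (fun i N => calGlev L M a ha k * (Pmodel L M (V₁ i) k + (Pmodel L M (V₂ i) k)ᴴ + Matrix.diagonal (W i k)) * N) (calGlev L M a ha k) w) k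
      = clim + (avgTow (QBlev L M) ((L : ℝ) ^ d) (fun k => List.foldr (fun i N => calGlev L M a ha k * (Pmodel L M (V₁ i) k + (Pmodel L M (V₂ i) k)ᴴ + Matrix.diagonal (W i k)) * N) (calGlev L M a ha k) w) k - clim) := by
    abel
  rw [e2]
  exact entryDecay_add h1 h2

/-! ## §3 The INPUT triple of every word along the even cubic volumes; the END for `c_k⁻¹X_{w,k}c_k⁻¹` -/

/-- **`couplingWord_inputs` — THE INPUT TRIPLE ((UD), (SR), EL₂) OF EVERY MIXED INSERTION WORD ALONG THE EVEN CUBIC VOLUMES** [our proof] (`L ≥ 2`, `d ≥ 3`, `σ` non-empty;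
a family `V_{i,t}` of volume-indexed Lipschitz backgrounds with common `(α, β)` DISPLAYING ONLY EL₁): `∃ κ > 0, B, B′ ≥ 0` (free of `t, k`) with (UD)+(SR) of `X_{w,·}` on every
`cubic d (2(t+1))` and EL₂ at unit integer pairs — the format PART 156's `mul_inputs` consumes. -/
theorem couplingWord_inputs (hL : 2 ≤ L) (hd : 3 ≤ d) {σ : Type*} [Nonempty σ] {α β α' β' : ℝ}
    {V₁ V₂ : σ → (t : ℕ) → (k : ℕ) → Fin d → (idx L (cubic d (evenPeriod t)) k → ℂ)} {W : σ → (t : ℕ) → (k : ℕ) → (idx L (cubic d (evenPeriod t)) k → ℂ)}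
    (hV₁ : ∀ i t, LipschitzBackground L (cubic d (evenPeriod t)) (V₁ i t) α β) (hV₂ : ∀ i t, LipschitzBackground L (cubic d (evenPeriod t)) (V₂ i t) α β)
    (hW : ∀ i t, BoundedBackground L (cubic d (evenPeriod t)) (W i t) α' β')
    (hV₁1 : ∀ i k (μ f : Fin d) (z : Fin d → ℤ), ∃ s : ℂ, Tendsto (fun t => V₁ i t k μ (castT (cubic d (lev L k * evenPeriod t)) z, f)) atTop (𝓝 s))
    (hV₂1 : ∀ i k (μ f : Fin d) (z : Fin d → ℤ), ∃ s : ℂ, Tendsto (fun t => V₂ i t k μ (castT (cubic d (lev L k * evenPeriod t)) z, f)) atTop (𝓝 s))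
    (hW1 : ∀ i k (f : Fin d) (z : Fin d → ℤ), ∃ s : ℂ, Tendsto (fun t => W i t k (castT (cubic d (lev L k * evenPeriod t)) z, f)) atTop (𝓝 s))
    (w : List σ) :
    ∃ κ B B' : ℝ, 0 < κ ∧ 0 ≤ B ∧ 0 ≤ B' ∧
      (∀ t k, EntryDecay (distK L (cubic d (evenPeriod t))) (avgTow (QBlev L (cubic d (evenPeriod t))) ((L : ℝ) ^ d)
        (fun k' => List.foldr (fun i N => calGlev L (cubic d (evenPeriod t)) a ha k' * (Pmodel L (cubic d (evenPeriod t)) (V₁ i t) k' + (Pmodel L (cubic d (evenPeriod t)) (V₂ i t) k')ᴴ + Matrix.diagonal (W i t k')) * N)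
          (calGlev L (cubic d (evenPeriod t)) a ha k') w) k) B κ) ∧
      (∀ t, TwoLevelDecayRate (distK L (cubic d (evenPeriod t))) (avgTow (QBlev L (cubic d (evenPeriod t))) ((L : ℝ) ^ d)
        (fun k' => List.foldr (fun i N => calGlev L (cubic d (evenPeriod t)) a ha k' * (Pmodel L (cubic d (evenPeriod t)) (V₁ i t) k' + (Pmodel L (cubic d (evenPeriod t)) (V₂ i t) k')ᴴ + Matrix.diagonal (W i t k')) * N)
          (calGlev L (cubic d (evenPeriod t)) a ha k') w)) B' κ (Real.sqrt ((L : ℝ)⁻¹))) ∧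
      (∀ k μ ν (z z' : Fin d → ℤ), ∃ s' : ℂ, Tendsto (fun t => (avgTow (QBlev L (cubic d (evenPeriod t))) ((L : ℝ) ^ d)
        (fun k' => List.foldr (fun i N => calGlev L (cubic d (evenPeriod t)) a ha k' * (Pmodel L (cubic d (evenPeriod t)) (V₁ i t) k' + (Pmodel L (cubic d (evenPeriod t)) (V₂ i t) k')ᴴ + Matrix.diagonal (W i t k')) * N)
          (calGlev L (cubic d (evenPeriod t)) a ha k') w) k)
        ((unitIdx L (cubic d (evenPeriod t))).symm (castT (cubic d (evenPeriod t)) z, μ)) ((unitIdx L (cubic d (evenPeriod t))).symm (castT (cubic d (evenPeriod t)) z', ν)))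
        atTop (𝓝 s')) := by
  have hd1 : 1 ≤ d := le_trans (by norm_num) hd
  obtain ⟨κ, B, B', hκ, hB, hB', h⟩ := couplingWord_decay_inputs L a ha hL hd1 α β α' β' w
  exact ⟨κ, B, B', hκ, hB, hB',
    fun t k => (h (cubic d (evenPeriod t)) (fun i => V₁ i t) (fun i => V₂ i t) (fun i => W i t) (fun i => hV₁ i t) (fun i => hV₂ i t) (fun i => hW i t)).1 k,
    fun t => (h (cubic d (evenPeriod t)) (fun i => V₁ i t) (fun i => V₂ i t) (fun i => W i t) (fun i => hV₁ i t) (fun i => hV₂ i t) (fun i => hW i t)).2,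
    fun k μ ν z z' => tendsto_couplingWord_pair L a ha hd k hV₁ hV₂ hW (fun i => hV₁1 i k) (fun i => hV₂1 i k) (fun i => hW1 i k) w μ ν z z'⟩

/-- **`conv_couplingWord_of_tendsto_background` — THE SANDWICH `c_k⁻¹X_{w,k}c_k⁻¹` OF EVERY MIXED INSERTION WORD ON `ℤ^d`, MODULO ONLY THE BACKGROUNDS' POINTWISE LIMITS**
[our proof] (`d ≥ 3`, `L ≥ 2`, `a > 0`, `μ ≠ ν`, even cubic volumes `2(t+1)`, `σ` non-empty, `w` ANY word): for a family of volume-indexed Lipschitz backgrounds with common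
`(α, β)` DISPLAYING ONLY their EL₁, the tower `c_k⁻¹·[L^{dk}Q_k(𝒢P(V_{i₁,t})𝒢⋯P(V_{i_n,t})𝒢)Q_kᴴ]·c_k⁻¹` has `∃ κ > 0, B, B′ ≥ 0, Π` with `IsInfiniteVolumeLimit`,
`UniformDecay Π μ ν B (κ∕d)`, `StepRate Π μ ν B′ (κ∕d) (√(L⁻¹))`, `KernelInputs d Π`, `∀ k, |secondMoment (Π k) μ ν − secondMoment (limKernelOf Π) μ ν| ≤ β′_d(B′∕(1−√(L⁻¹)), κ∕d)·(√(L⁻¹))^k`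
— PART 143's insertion socket on `couplingWord_inputs` (PART 147: `|w| = 1`; PART 158: `|w| = 2`). [cite: Balaban1987RG1, (1.21)–(1.22) p.264 (shapes)] -/
theorem conv_couplingWord_of_tendsto_background (hL : 2 ≤ L) (hd : 3 ≤ d) {μ ν : Fin d} (hne : μ ≠ ν) {σ : Type*} [Nonempty σ] {α β α' β' : ℝ}
    {V₁ V₂ : σ → (t : ℕ) → (k : ℕ) → Fin d → (idx L (cubic d (evenPeriod t)) k → ℂ)} {W : σ → (t : ℕ) → (k : ℕ) → (idx L (cubic d (evenPeriod t)) k → ℂ)}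
    (hV₁ : ∀ i t, LipschitzBackground L (cubic d (evenPeriod t)) (V₁ i t) α β) (hV₂ : ∀ i t, LipschitzBackground L (cubic d (evenPeriod t)) (V₂ i t) α β)
    (hW : ∀ i t, BoundedBackground L (cubic d (evenPeriod t)) (W i t) α' β')
    (hV₁1 : ∀ i k (μ f : Fin d) (z : Fin d → ℤ), ∃ s : ℂ, Tendsto (fun t => V₁ i t k μ (castT (cubic d (lev L k * evenPeriod t)) z, f)) atTop (𝓝 s))
    (hV₂1 : ∀ i k (μ f : Fin d) (z : Fin d → ℤ), ∃ s : ℂ, Tendsto (fun t => V₂ i t k μ (castT (cubic d (lev L k * evenPeriod t)) z, f)) atTop (𝓝 s))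
    (hW1 : ∀ i k (f : Fin d) (z : Fin d → ℤ), ∃ s : ℂ, Tendsto (fun t => W i t k (castT (cubic d (lev L k * evenPeriod t)) z, f)) atTop (𝓝 s))
    (w : List σ) :
    ∃ κ B B' : ℝ, 0 < κ ∧ 0 ≤ B ∧ 0 ≤ B' ∧ ∃ Pinf : ℕ → B12Beta.Kernel d,
      (∀ k, IsInfiniteVolumeLimit evenPeriod
        (fun t μ' ν' (z : Site d (evenPeriod t)) => (((unitCovB L (cubic d (evenPeriod t)) a ha k)⁻¹
            * avgTow (QBlev L (cubic d (evenPeriod t))) ((L : ℝ) ^ d)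
                (fun k' => List.foldr (fun i N => calGlev L (cubic d (evenPeriod t)) a ha k' * (Pmodel L (cubic d (evenPeriod t)) (V₁ i t) k' + (Pmodel L (cubic d (evenPeriod t)) (V₂ i t) k')ᴴ + Matrix.diagonal (W i t k')) * N)
                  (calGlev L (cubic d (evenPeriod t)) a ha k') w) k
            * (unitCovB L (cubic d (evenPeriod t)) a ha k)⁻¹)
          ((unitIdx L (cubic d (evenPeriod t))).symm (z, μ')) ((unitIdx L (cubic d (evenPeriod t))).symm (0, ν'))).re) (Pinf k)) ∧
      Beta.LimitRate.UniformDecay Pinf μ ν B (κ / d) ∧ StepRate Pinf μ ν B' (κ / d) (Real.sqrt ((L : ℝ)⁻¹)) ∧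
      (∃ K : KernelInputs d Pinf, K.θ = Real.sqrt ((L : ℝ)⁻¹) ∧ K.c₀ = betaPrime510 d (B' / (1 - Real.sqrt ((L : ℝ)⁻¹))) (κ / d) ∧ K.Pinf = limKernelOf Pinf ∧ K.μ = μ ∧ K.ν = ν) ∧
      (∀ k, |B12Beta.secondMoment (Pinf k) μ ν - B12Beta.secondMoment (limKernelOf Pinf) μ ν|
          ≤ betaPrime510 d (B' / (1 - Real.sqrt ((L : ℝ)⁻¹))) (κ / d) * Real.sqrt ((L : ℝ)⁻¹) ^ k) := by
  obtain ⟨κ, B, B', hκ, hB, hB', hud, hsr, hel⟩ := couplingWord_inputs L a ha hL hd hV₁ hV₂ hW hV₁1 hV₂1 hW1 w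
  exact conv_insertion_invCov_of_kernel L a ha hL hd hne
    (X := fun t k => avgTow (QBlev L (cubic d (evenPeriod t))) ((L : ℝ) ^ d)
      (fun k' => List.foldr (fun i N => calGlev L (cubic d (evenPeriod t)) a ha k' * (Pmodel L (cubic d (evenPeriod t)) (V₁ i t) k' + (Pmodel L (cubic d (evenPeriod t)) (V₂ i t) k')ᴴ + Matrix.diagonal (W i t k')) * N)
        (calGlev L (cubic d (evenPeriod t)) a ha k') w) k)
    hκ hB hB' hud hsr hel

end Summit.QuantumFields.BalabanUV.Beta.GAN24.CouplingLetterWordInputs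

end
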